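import Summits.QuantumFields.YangMills.Theorems.IR.LevelwiseDominationTower
import HarnessLib

/-!
# Crux `IRcof` (stmt-QuantumFields-26930) — supplier line «lipschitz-vacuum-transport», part 5: the GAP content of a level matching
# («STRONGER than PXcof(1∕24)» made explicit: LW-DOM carries a volume-UNIFORM spectral gap in floor units)

Helper module for `Summit.QuantumFields.YangMills.Theses.BalabanLadder.IRcof` (`--supports stmt-QuantumFields-26930`; closes nothing), crux LEAD
ymfull-r2c-lead-1 g1.  Under a level matching of mass `m > 0` the vacuum index is the only level sent to the empty occupation, so EVERY other
level satisfies `rr i ≤ e^{−m}` (`ratio_le_exp_neg_mass_of_levelMatched`): a spectral gap `≥ m` in lattice units.  Read through the line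
statement `LevelwiseDominatedCofinal` (mass `μ·a(β)`, pinned volumes `a(β)·L ∈ [T, 2T]` for EVERY `T ≥ T₀`, cofinally in `β`), this is a gap
`≥ μ` in floor units UNIFORM IN THE PHYSICAL VOLUME along a cofinal set of couplings (`uniformGap_of_levelwise`) — i.e. LW-DOM contains the
volume-uniform lattice mass gap, which is why the LEAD booked the line as a SUPPLIER of the weaker slot stub PXcof(1∕24) (one pinned volume,
purity only) rather than as line of record (`Cruxes/IRcof/PICKED.md`).

HONEST FRAMING: conditional bookkeeping about an OPEN, width-0 line statement; nothing here proves `LevelwiseDominatedCofinal`,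
`PinnedExitsCofinalAt (1/24)`, `IRnscCof`, `IRcof`, `IR`, any leg, or the Yang–Mills mass gap (Clay) — NOT proved; NOT continuum ∕ OS.
-/

set_option autoImplicit false

noncomputable section

open Filter Topology MeasureTheory
open scoped BigOperators
open Literature.MathematicalPhysics.QuantumFieldTheory Literature.MathematicalPhysics.QuantumLattice
open Summit.QuantumFields.YangMills.Cruxes.OSLegsFromFemtoAndGap.DlrCollarTransfer (LowerBounds)
open Summit.QuantumFields.YangMills.Cruxes.IR.RankPurity (IsRatioDatum)

namespace Summit.QuantumFields.YangMills.Cruxes.IR.LevelwiseDomination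

/-- **Gap content of a level matching.**  If `rr` is level-matched into the free tower of mass `m > 0` and `rr i₀ = 1`, then every other
level satisfies `rr i ≤ e^{−m}`: the vacuum is the only level on the empty occupation (injectivity on the support), and every non-empty
occupation has energy `≥ m`. -/
theorem ratio_le_exp_neg_mass_of_levelMatched {ι : Type} {rr : ι → ℝ} {d : ℕ} {m c : ℝ} {L : ℕ} (hm : 0 < m)
    (h : LevelMatched rr d m c L) {i₀ : ι} (h1 : rr i₀ = 1) {i : ι} (hi : i ≠ i₀) :
    rr i ≤ Real.exp (-m) := by
  obtain ⟨f, hinj, hle⟩ := h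
  by_cases hri : rr i = 0
  · rw [hri]; exact (Real.exp_pos _).le
  -- the vacuum sits on the empty occupation
  have hfi0 : f i₀ = 0 := by
    by_contra hne
    have hE : m ≤ occupationEnergy d m c L (f i₀) := mass_le_occupationEnergy d hm.le c L hne
    have h2 := hle i₀
    rw [h1] at h2
    have : Real.exp (-(occupationEnergy d m c L (f i₀))) < 1 := by
      rw [← Real.exp_zero]; exact Real.exp_lt_exp.2 (by linarith)
    linarith
  -- hence `f i ≠ 0` by injectivity on the support, and its energy is `≥ m`
  have hi0S : i₀ ∈ {k | rr k ≠ 0} := by simp [h1]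
  have hiS : i ∈ {k | rr k ≠ 0} := by simpa using hri
  have hfi : f i ≠ 0 := fun hzero => hi (hinj hiS hi0S (hzero.trans hfi0.symm))
  have hE : m ≤ occupationEnergy d m c L (f i) := mass_le_occupationEnergy d hm.le c L hfi
  exact (hle i).trans (Real.exp_le_exp.2 (by linarith))

/-- **LW-DOM ⇒ a volume-UNIFORM gap in floor units, cofinally in `β`.**  For simply-connected compact simple `G`, every `r`, every positive
unit `a → 0` carrying the floor: there are `μ > 0` and `T₀` such that for EVERY `T ≥ T₀`, cofinally in `β`, some pinned torus
`a(β)·L ∈ [T, 2T]`, `L ≥ 8`, has ALL its transfer-matrix ratio levels (every ratio datum `IsRatioDatum r.ρ β L`) below `e^{−μ·a(β)}` off the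
vacuum — the lattice mass gap `≥ μ·a(β)` uniformly in the physical volume.  Conditional on the open line statement; proves nothing by itself. -/
theorem uniformGap_of_levelwise (h : LevelwiseDominatedCofinal) :
    ∀ (G : Type) [Group G] [TopologicalSpace G] [IsTopologicalGroup G] [CompactSpace G],
      IsCompactSimpleLieGroup G → SimplyConnectedSpace G →
      letI : MeasurableSpace G := borel G
      haveI : BorelSpace G := ⟨rfl⟩
      ∀ (r : LatticeRep G) (a : ℝ → ℝ), (∀ β, 0 < a β) → Tendsto a atTop (𝓝 0) → LowerBounds G r a →
        ∃ (μ T₀ : ℝ), 0 < μ ∧ ∀ T : ℝ, T₀ ≤ T → ∀ β₁ : ℝ, ∃ β : ℝ, β₁ ≤ β ∧ 0 ≤ β ∧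
          ∃ (L : ℕ) (_ : NeZero L), 8 ≤ L ∧ T ≤ a β * (L : ℝ) ∧ a β * (L : ℝ) ≤ 2 * T ∧
            ∀ (ι : Type) [DecidableEq ι] (rr : ι → ℝ) (i₀ : ι), IsRatioDatum r.ρ β L ι rr i₀ →
              ∀ i, i ≠ i₀ → rr i ≤ Real.exp (-(μ * a β)) := by
  intro G _ _ _ _ hG hsc
  letI : MeasurableSpace G := borel G
  haveI : BorelSpace G := ⟨rfl⟩
  intro r a ha ha0 hlb
  obtain ⟨d, c, μ, T₀, -, hμ, hdom⟩ := h G hG hsc r a ha ha0 hlb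
  refine ⟨μ, T₀, hμ, fun T hT β₁ => ?_⟩
  obtain ⟨β, hβ₁, hβ0, L, instL, hL8, hTle, hleT, hlw⟩ := hdom T hT β₁
  refine ⟨β, hβ₁, hβ0, L, instL, hL8, hTle, hleT, fun ι _ rr i₀ hrd i hi => ?_⟩
  have hm : 0 < μ * a β := mul_pos hμ (ha β)
  exact ratio_le_exp_neg_mass_of_levelMatched hm (hlw ι rr i₀ hrd) hrd.2.1 hi

end Summit.QuantumFields.YangMills.Cruxes.IR.LevelwiseDomination

end
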